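import Literature.MathematicalPhysics.QuantumFieldTheory.Balaban1983to89.Node00.N24Thm1Stage13RebindXWithB8PinB10YZW0SepCoPHG
import Summits.QuantumFields.YangMills.Theorems.BalabanUVNodesN13NodeAtRevisedRecordWorldAtRecord13SepCoPHV

/-!
# NODE N24 (B2) — THE THIRTEEN NODES AT A WORLD RE-BOUND TO A REVISED RECORD DATUM `datumOfRecord₁₃SepCoPHV θ h v` from THE TWELVE VERSION-BLIND NODES + THE
# 𝐑-LEAF AT THE RECORD WORLD (engine A2, Part 36 v1.1 §2) and N13's SLOT LETTER «(2.50)'s row ON THE RE-CHOSEN DENSITIES `v.ρ`» — the engine half of the rung-1ⱽ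
# road of K1⁹'s LINE 2 (plan g86 skeleton v9 e3ea62ca8052a293, stub `stub_nodes13PWSV`; director-ym №214)

TRACK A (YM-PLAN §2d, node N24 = binder B2), seat `pub-ymgap-dag-n24-c` (R134 s2; gen 11, Part 38a); `--supports` K1⁹ stmt-QuantumFields-27364 as a helper (Summits lane).
WHY.  K1⁹'s LINE 2 (v9 §R9V) asks rung 1 at a world `w` with `w.C = (datumOfRecord₁₃SepCoPHV F 2 θ h v).C` — ALL THIRTEEN nodes there; by dag-n13-w3's p624688 only N13 reads the
slot (`leavesP_revision₁₃_eq_update`: every leaf but `uvBounds` is that of the same world re-bound to the record datum).  N24's engines build worlds ON THE RECORD (`w₀.C = datum.C`) and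
need N13's row POINTWISE there; Part 36 (p625431 + v1.1 §2) splits engine A2 so that the TWELVE version-blind nodes `Dag.B4_main … Dag.B15_main` and the 𝐑-leaf come WITHOUT N13.
THIS FILE (general `N`, no door, no cube letter): §0 `N24_nodes12_rOperation₁₃CoPH_rebindXS_fourPin_pointed` — Part 8's S-VIEW engine (`N24NodesStage13PinX3HSSepCoPH` §1, the
registered rung-1 world class's binding `upOfRecord₅CS ((θ.rebindX X′).view₁₃CoPHB10YZW …)`) minus N13's row ⇒ the TWELVE version-blind nodes ∧ `rOperation`; §1
`N24_nodes_at_revisedWorld_of_nodes12_of_rOperation_of_uvRowV` — for ANY world `w₀` on the record with the twelve nodes + `rOperation`, ANY version `v` and N13's SLOT LETTER at `w₀`'s letters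
(`hUVV`: below `γ₁ ≥ w₀.γ`, at `SLaw`-levels, Part 34's two-sided row with the record's `χβ`, `A^η`, `g` and exponents `w₀.em ∕ w₀.ep`, ON `v.ρ P k U` — dag-n13-w3's `hUVV` shape), the world
RE-BOUND to the revised datum `{w₀ with C := (datumOfRecord₁₃SepCoPHV θ h v).C}` carries ALL THIRTEEN nodes (N13 by `b16_main_of_rOperation_of_uvSlot ∘ uvSlot_at_construction` at `ρ := v.ρ`,
the twelve along `leavesP_revision₁₃_eq_update`); §2 ∕ §3 the same at engine A2's world (Part 36 v1.1 §2) ∕ at Part 8's S-view world (§0); §4 `N24_nodesAtSomeRecordSV₁₃SepCoPH_of_rebindXS_fourPin_pointed_slotLetter`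
— LINE 2's RUNG-1 BODY (`NodesAtSomeRecord13PWSV` with `RecordSV` written out) over the S-view of `θ.rebindX X′` with N13 as the slot letter (Part 8's rung-1 lemma re-cut to the slot; the
world class displayed AS REGISTERED — S-view, un-guarded [IV] pin; plan g86 «R1W» ∕ FLAG №4 pending, bus 2026-08-28T11:17:46Z).
HONEST FRAMING: composition BY NAME (Part 36, dag-n13-w3 p624688, `B16NodeKnitRecord5` ∕ `B16NodeKnitRepTowerOfRecord`); NO estimate; nothing of Bałaban's asserted; every node input
DISPLAYED; N13 NOT discharged (the slot letter is a HYPOTHESIS); no stub closed; N24 COMPOSITE — no count moved (5∕27 · A 5∕28); R4 = the conditional finite-𝕋⁴ rung `BalabanLadder.UV`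
only — NOT continuum ∕ ℝ⁴ ∕ OS ∕ mass gap ∕ Clay.
-/

noncomputable section

open scoped Matrix.Norms.L2Operator BigOperators

namespace Summit.QuantumFields.YangMills.BalabanUVNodes.N24NodesAtRevisedWorldOfNodes12SlotLetter

open Literature.MathematicalPhysics.QuantumFieldTheory.Balaban1983to89
open Literature.MathematicalPhysics.QuantumFieldTheory.Balaban1983to89.Node00
open DagBinding T4Continuum T4DatumAssembly FlowStepRuns AveragingRT
open B16NodeKnitRepTowerOfRecord (uvSlot_at_construction)
open B16NodeKnitRecord5 (b16_main_of_rOperation_of_uvSlot)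
open B14NodeKnitRecord9 (b14_main_at_construction_rhoOfRecord9_along)
open Summit.QuantumFields.YangMills.BalabanUVNodes.N13NodeAtRevisedRecordWorldAtRecord13SepCoPHV (leavesP_revision₁₃_eq_update)

variable {F : T4Family} {N : ℕ} [NeZero N]

/-! ## §0. The TWELVE version-blind nodes + the 𝐑-leaf at a world S-BOUND to the four-pin view of `θ.rebindX X′` (Part 8's S-engine `N24_nodes₁₃CoPH_rebindXS_fourPin_pointed` minus N13) -/

/-- **★ N24 · THE TWELVE NODES N01–N12 AND THE 𝐑-OPERATION LEAF AT A WORLD S-BOUND TO `upOfRecord₅CS ((θ.rebindX X′).view₁₃CoPHB10YZW M⋆ ops ζ λW)`** (the S-view of the registered rung-1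
world class `RecordS`): Part 8's engine (`N24NodesStage13PinX3HSSepCoPH` §1) with N13's pointwise (2.50) row `hUV` DROPPED — the same proof bytes minus the `B16_main` line — ⇒ the twelve nodes
`Dag.B4_main … Dag.B15_main` ∧ `(leavesP w P).rOperation` at every run (N05 = the S-view's own [B8] leaf `h05S`; N12 = the pure pin `h12`). [cite: Balaban1989LargeFieldII, Thm 1 p.355, (0.1) pp.355–356, p.387, p.391; Balaban1985RegularSpaces, Lemma 1 – Thm 8 pp.79–101, Prop. 7 (1.145) p.100, Thm 8 (1.146) p.101; Balaban1985UV3, Thm 1 p.257, Thm 2 p.258; Balaban1985BackgroundPropagators, Thm 3.1 p.397; Balaban1985Variational, Thm 1 p.279, Prop. 7 p.303, Prop. 8 p.304; Balaban1987RG1, Thm 3 p.264, (0.17)–(0.20) pp.255–256, Thm 2 p.259; Balaban1988RG2Cluster, (2.41) p.21; Balaban1988Convergent, Thm 2 p.263; Balaban1989LargeFieldI, (0.2)–(0.6) p.176 (bookkeeping)] -/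
theorem N24_nodes12_rOperation₁₃CoPH_rebindXS_fourPin_pointed (θ : Stage13HParams F N) (hP : θ.Provisos₁₃CoPH F N) (hθ : θ.Admissible F N)
    (X' : B12.RunParams → PrintedCarriersR) (Mstar : ℕ) (ops : OpsY N θ.toStage3Params Mstar) (ζ : ResidZ F N) (lamW : ResidW F N) (w : WorldP)
    (hC : w.C = (datumOfRecord₁₃CoPH F N θ hP).C) (hγ : 0 < w.γ ∧ w.γ ≤ θ.γ) (hL : w.L = (θ.L : ℝ))
    (hup : ∀ P, w.up P = upOfRecord₅CS F N ((θ.rebindX F N X').view₁₃CoPHB10YZW F N Mstar ops ζ lamW) P)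
    (h05S : ∀ P : B12.RunParams, (upOfRecord₅CS F N ((θ.rebindX F N X').view₁₃CoPHB10YZW F N Mstar ops ζ lamW) P).b8)
    (h06 : B9LeafX (Y9OfRecord N θ.toStage3Params Mstar ops))
    (h07 : B11Leaf (Z11OfRecord F N ζ))
    (h08 : PrintedUV3V N θ.L)
    (h09 : ∀ P : B12.RunParams, B12Sec2to5.Lemma4Printed (X' P).F12 (X' P).c12)
    (h09T : ∀ P : B12.RunParams, (leavesP w P).smallCouplings → (leavesP w P).smallFieldInductive)
    (h10 : ∀ P : B12.RunParams, B9LeafX (Y9OfRecord N θ.toStage3Params Mstar ops) →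
      (B10.Thm1PrintedCompact (((θ.rebindX F N X').view₁₃CoPHB10YZW F N Mstar ops ζ lamW).res.X P).runs10 ∧
          B10.Thm2Printed (((θ.rebindX F N X').view₁₃CoPHB10YZW F N Mstar ops ζ lamW).res.X P).runs10) →
        B11Leaf (Z11OfRecord F N ζ) → B12Sec2to5.Lemma4Printed (X' P).F12 (X' P).c12 →
          B13.Lemma1Printed (X' P).S13 (X' P).c13 ∧ B13.Lemma2Printed (X' P).S13 (X' P).c13 ∧
            B13.Lemma3Printed (X' P).S13 (X' P).c13)
    (h11 : ∀ P : B12.RunParams, (leavesP w P).b7 → (leavesP w P).b8 → (leavesP w P).b9 → (leavesP w P).b10 → (leavesP w P).b11 →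
      (leavesP w P).smallCouplings → (leavesP w P).smallFieldInductive → (leavesP w P).flowControl →
        ∀ k, k < P.K → SLaw₁₃CoPH F N θ P k → TLaw₁₃CoPH F N θ P k)
    (h12 : ∀ P : B12.RunParams, B15Leaf (WOfRecord₁₃ F N θ.toStage13Params lamW P))
    (hR : ∀ (P : B12.RunParams) (k : ℕ), k < P.K → TLaw₁₃CoPH F N θ P k → SLaw₁₃CoPH F N θ P (k + 1)) :
    ∀ P : B12.RunParams, (Dag.B4_main (leavesP w P) ∧ Dag.B5_main (leavesP w P) ∧ Dag.B6_main (leavesP w P) ∧ Dag.B7_main (leavesP w P) ∧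
      Dag.B8_main (leavesP w P) ∧ Dag.B9_main (leavesP w P) ∧ Dag.B10_main (leavesP w P) ∧ Dag.B11_main (leavesP w P) ∧
      Dag.B12_main (leavesP w P) ∧ Dag.B13_main (leavesP w P) ∧ Dag.B14_main (leavesP w P) ∧ Dag.B15_main (leavesP w P)) ∧ (leavesP w P).rOperation := by
  intro P
  have hrec' := N24_isRecordOfRecord₁₃CCoPH_twin_of_upS_rebindX_view θ hP hθ X' Mstar ops ζ lamW w hC hγ hL
  have hw8 : ∀ P, w.up P = (upOfRecord₅C F N ((θ.rebindX F N X').view₁₃CoPHB10YZW F N Mstar ops ζ lamW) P).withB8 (leavesP w P).b8 := fun P => by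
    show w.up P = (upOfRecord₅C F N _ P).withB8 (w.up P).b8
    rw [hup P]
    exact upOfRecord₅CS_eq_withB8 F N _ P
  have hleaves := leavesP_eq_of_up_withB8 hw8 P
  have h4 : Dag.B4_main (leavesP w P) := by rw [hleaves]; exact b4_main_of_isRecordOfRecord₁₃CCoPH hrec' P
  have h5 : Dag.B5_main (leavesP w P) := by rw [hleaves]; exact b5_main_of_isRecordOfRecord₁₃CCoPH hrec' P
  have h6 : Dag.B6_main (leavesP w P) := by rw [hleaves]; exact N24_b6_main_of_isRecordOfRecord₁₃CCoPH hrec' P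
  have h7 : Dag.B7_main (leavesP w P) := by rw [hleaves]; exact b7_main_of_isRecordOfRecord₁₃CCoPH hrec' P
  have hl := upOfRecord₅C_view₁₃CoPHB10YZW_leaves F N (θ.rebindX F N X') Mstar ops ζ lamW P
  have h8 : (w.up P).b8 := by
    rw [hup P]; exact h05S P
  have h9 : (w.up P).b9 := by rw [hup P]; exact hl.2.1.2 h06
  have h10leaf : (w.up P).b10 := by rw [hup P]; exact hl.2.2.1.2 h08
  have h11leaf : (w.up P).b11 := by rw [hup P]; exact hl.2.2.2.2 h07
  have h15 : (w.up P).rBasicStep := by rw [hup P]; exact hl.1.2 (h12 P)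
  have h12leaf : (leavesP w P).b12 := by
    show (w.up P).b12
    rw [hup P]; exact h09 P
  have h13 : Dag.B13_main (leavesP w P) := by
    have h' : Dag.B13_main (leavesP { w with up := fun P => upOfRecord₅C F N ((θ.rebindX F N X').view₁₃CoPHB10YZW F N Mstar ops ζ lamW) P } P) :=
      B13NodeKnitRecord5C.b13_main_at_stage5ParamsC F N ((θ.rebindX F N X').view₁₃CoPHB10YZW F N Mstar ops ζ lamW) _ P rfl (h10 P)
    show (w.up P).b9 → (w.up P).b10 → (w.up P).b11 → (w.up P).b12 → (w.up P).b13
    rw [hup P]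
    exact h'
  have hrop := N24_rOperation_iff_of_upS_rebindX_view_coPH θ X' Mstar ops ζ lamW (hup P)
  exact ⟨⟨h4, h5, h6, h7, B8LeafKnit.b8_main_of_leaf w P h8, fun _ _ _ _ => h9, fun _ _ _ _ _ _ => h10leaf,
    fun _ _ _ _ _ => h11leaf, B12NodeKnitRecord8.b12_main_of_leaf_of_thm3Member h12leaf (h09T P), h13,
    b14_main_at_construction_rhoOfRecord9_along F N (coreOfRecord₁₃CoPH F N θ) w P θ.ν θ.τ9 (EOfRecord₁₃ F N θ.toStage13Params) (wOfRecord₉ F N θ.toStage9Params) θ.ppSel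
      (gOfRecord₁₃ F N θ.toStage13Params) (fun p k _ => SLaw₁₃CoPH F N θ p k) (fun p k _ => TLaw₁₃CoPH F N θ p k) (hC.trans (datumOfRecord₁₃CoPH_C F N θ hP))
      (fun _ _ => Iff.rfl) (fun _ => sLaw₁₃CoPH_zero F N θ P) (h11 P) (fun hr => hrop.1 hr),
    B15LeafKnit.b15_main_of_up (U := w.up P) rfl h15⟩, hrop.2 (hR P)⟩

/-! ## §1. World-generic: twelve version-blind nodes + 𝐑-leaf on the record, N13's slot letter on `v.ρ` ⟹ the thirteen nodes at the re-bound world -/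

/-- **★ THE THIRTEEN NODES AT THE WORLD RE-BOUND TO A REVISED DATUM** (general `N`, any world `w₀` on the record, any version `v`): the twelve version-blind nodes and the 𝐑-leaf at `w₀`
plus N13's SLOT LETTER on `v.ρ` at `w₀`'s letters (`γ₁ ≥ w₀.γ`, `w₀.em`, `w₀.ep`) ⟹ `Nodes (leavesP {w₀ with C := (datumOfRecord₁₃SepCoPHV θ h v).C} P)` at every run.  N13 by
`b16_main_of_rOperation_of_uvSlot` ∘ `uvSlot_at_construction` at `ρ := v.ρ` (trivial representation; `Laws k := SLaw₁₃CoPH θ P k` via def-T's `sect2Form_coreOfRecord₁₃CoPH_iff`) — dag-n13-w3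
p624688 §2's proof at a generic up-binding (the 𝐑-leaf reads `w.up` only); the twelve by `leavesP_revision₁₃_eq_update` + the structure-update identity of `nodes_update_uvBounds`.
[cite: Balaban1989LargeFieldII, Thm 1 p.355, (0.1) pp.355–356, p.387, p.391; Balaban1988Convergent, (0.2) p.244, Cor. 3 (2.50) p.264 (bookkeeping)] -/
theorem N24_nodes_at_revisedWorld_of_nodes12_of_rOperation_of_uvRowV (θ : Stage13HParams F N) (h : θ.Provisos₁₃SepCoPH F N) (v : Revision₁₃ F N θ h)
    (w₀ : WorldP) (hC₀ : w₀.C = (datumOfRecord₁₃SepCoPH F N θ h).C)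
    (h12 : ∀ P : B12.RunParams,
      Dag.B4_main (leavesP w₀ P) ∧ Dag.B5_main (leavesP w₀ P) ∧ Dag.B6_main (leavesP w₀ P) ∧ Dag.B7_main (leavesP w₀ P) ∧
      Dag.B8_main (leavesP w₀ P) ∧ Dag.B9_main (leavesP w₀ P) ∧ Dag.B10_main (leavesP w₀ P) ∧ Dag.B11_main (leavesP w₀ P) ∧
      Dag.B12_main (leavesP w₀ P) ∧ Dag.B13_main (leavesP w₀ P) ∧ Dag.B14_main (leavesP w₀ P) ∧ Dag.B15_main (leavesP w₀ P))
    (hrop : ∀ P : B12.RunParams, (leavesP w₀ P).rOperation) {γ₁ : ℝ} (hγ : w₀.γ ≤ γ₁)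
    (hUVV : ∀ P : B12.RunParams, (genFlow (betaOfRecord₁₃ F N θ.toStage13Params) P.g0).InInterval γ₁ P.K → ∀ k, k ≤ P.K → SLaw₁₃CoPH F N θ P k →
      ∀ U : GaugeField (F.P P.K) k (SU N),
        chiβOfRecord₁₃ F N θ.toStage13Params P.K (gOfRecord₁₃ F N θ.toStage13Params P) k U *
              Real.exp (-(1 / (gOfRecord₁₃ F N θ.toStage13Params P k) ^ 2 * wilsonBGOfRecord F N θ.εbg P k U)
                - w₀.em (gOfRecord₁₃ F N θ.toStage13Params P k) * (Fintype.card (Site (F.P P.K) k) : ℝ)) ≤ v.ρ P k U ∧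
        v.ρ P k U ≤ Real.exp (w₀.ep (gOfRecord₁₃ F N θ.toStage13Params P k) * (Fintype.card (Site (F.P P.K) k) : ℝ))) :
    ∀ P : B12.RunParams, Nodes (leavesP { w₀ with C := (datumOfRecord₁₃SepCoPHV F N θ h v).C } P) := by
  intro P
  have hC : ({ w₀ with C := (datumOfRecord₁₃SepCoPHV F N θ h v).C } : WorldP).C = (datumOfRecord₁₃SepCoPHV F N θ h v).C := rfl
  have h16 : Dag.B16_main (leavesP { w₀ with C := (datumOfRecord₁₃SepCoPHV F N θ h v).C } P) :=
    b16_main_of_rOperation_of_uvSlot _ P (hrop P)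
      (uvSlot_at_construction F N (coreOfRecord₁₃CoPH F N θ) v.ρ { w₀ with C := (datumOfRecord₁₃SepCoPHV F N θ h v).C } P (Rep := fun _ => Unit) (fun _ => ())
        (fun k _ => SLaw₁₃CoPH F N θ P k) (fun k _ => v.ρ P k)
        (hC.trans (datumOfRecord₁₃SepCoPHV_C F N θ h v)) (fun _ => rfl) (fun k _ hs => (sect2Form_coreOfRecord₁₃CoPH_iff F N θ P k).1 hs) hγ (hUVV P))
  have key := leavesP_revision₁₃_eq_update F N θ h v { w₀ with C := (datumOfRecord₁₃SepCoPHV F N θ h v).C } P hC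
  have hw : ({ ({ w₀ with C := (datumOfRecord₁₃SepCoPHV F N θ h v).C } : WorldP) with C := (datumOfRecord₁₃SepCoPH F N θ h).C } : WorldP) = w₀ := by
    obtain ⟨C₀, up, γ, L, b, βup, β₀, gR, em, ep⟩ := w₀
    cases hC₀
    rfl
  rw [hw] at key
  rw [key] at h16 ⊢
  obtain ⟨h4, h5, h6, h7, h8, h9, h10, h11, h12', h13, h14, h15⟩ := h12 P
  exact ⟨h4, h5, h6, h7, h8, h9, h10, h11, h12', h13, h14, h15, h16⟩


/-! ## §2. At engine A2's world (generic four-pin chain over `θ.rebindX X′`, `W₀`, `b8sel` free): A2 §1's hypotheses with N13's pointwise row REPLACED by the slot letter on `v.ρ` -/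

/-- **★ N24 · THE THIRTEEN NODES AT ENGINE A2's WORLD RE-BOUND TO THE REVISED DATUM `datumOfRecord₁₃SepCoPHV θ h v`** (general `N`; `X′`, `W₀`, `b8sel` FREE): engine A2 §1's hypotheses
(N05 ← `h05G`; N06 ∕ N07 ∕ N08 leaves; N09 + `h09T`; N10 socket; N11 (S1ᵀ) `h11`; N12 `h12W : ∀ P, B15Leaf (W₀ P)`; the 𝐑-reading `hR`) with N13's POINTWISE row `hUV` on the record densities
REPLACED by the SLOT LETTER `hUVV` — Part 34's two-sided row ON THE RE-CHOSEN DENSITIES `v.ρ P k U` below `γ₁ ≥ w.γ` at `SLaw`-levels (what the version slot carries by construction from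
N13's a.e. rows: dag-n13-w2's producer ∕ dag-n13-w3 p624688 §2) ⟹ ALL THIRTEEN nodes at every run of `{w with C := (datumOfRecord₁₃SepCoPHV θ h v).C}`.  = Part 36 v1.1 §2 ∘ §1.
The rung-1ⱽ WORLD CLASS (S-view binding, [IV] pin) is NOT asserted here (plan g86 «R1W»). [cite: Balaban1989LargeFieldII, Thm 1 p.355, (0.1) pp.355–356, p.387, p.391; Balaban1988Convergent, (0.2) p.244, Cor. 3 (2.50) p.264, Thm 2 p.263; Balaban1985RegularSpaces, Prop. 7 (1.145) p.100, Thm 8 (1.146) p.101; Balaban1985UV3, Thm 1 p.257; Balaban1985Variational, Thm 1 p.279, Prop. 8 p.304; Balaban1987RG1, Thm 3 p.264, (0.17)–(0.20) pp.255–256; Balaban1989LargeFieldI, (0.2)–(0.6) p.176 (bookkeeping)] -/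
theorem N24_nodes13_at_revisedWorld₁₃SepCoPH_rebindX_withB8_pinB10YZW₀_pointed (θ : Stage13HParams F N) (hP : θ.Provisos₁₃SepCoPH F N) (hθ : θ.Admissible F N)
    (X' : B12.RunParams → PrintedCarriersR) (Mstar : ℕ) (ops : OpsY N θ.toStage3Params Mstar) (ζ : ResidZ F N)
    (W₀ : B12.RunParams → PrintedCarriers15) (b8sel : B12.RunParams → Prop) (w : WorldP)
    (hC : w.C = (datumOfRecord₁₃SepCoPH F N θ hP).C) (hγ : 0 < w.γ ∧ w.γ ≤ θ.γ) (hL : w.L = (θ.L : ℝ))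
    (hup : ∀ P, w.up P = (upOfRecord₅C F N ((((((θ.rebindX F N X').toStage5₁₃CoPH F N).pinB10 F N).pinY F N (Y9OfRecord N θ.toStage3Params Mstar ops)).pinZ F N (Z11OfRecord F N ζ)).pinW F N W₀) P).withB8 (b8sel P))
    (h05G : ∀ P : B12.RunParams, b8sel P)
    (h06 : B9LeafX (Y9OfRecord N θ.toStage3Params Mstar ops))
    (h07 : B11Leaf (Z11OfRecord F N ζ))
    (h08 : PrintedUV3V N θ.L)
    (h09 : ∀ P : B12.RunParams, B12Sec2to5.Lemma4Printed (X' P).F12 (X' P).c12)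
    (h09T : ∀ P : B12.RunParams, (leavesP w P).smallCouplings → (leavesP w P).smallFieldInductive)
    (h10 : ∀ P : B12.RunParams, B9LeafX (Y9OfRecord N θ.toStage3Params Mstar ops) →
      (B10.Thm1PrintedCompact (((((((θ.rebindX F N X').toStage5₁₃CoPH F N).pinB10 F N).pinY F N (Y9OfRecord N θ.toStage3Params Mstar ops)).pinZ F N (Z11OfRecord F N ζ)).pinW F N W₀).res.X P).runs10 ∧
          B10.Thm2Printed (((((((θ.rebindX F N X').toStage5₁₃CoPH F N).pinB10 F N).pinY F N (Y9OfRecord N θ.toStage3Params Mstar ops)).pinZ F N (Z11OfRecord F N ζ)).pinW F N W₀).res.X P).runs10) →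
        B11Leaf (Z11OfRecord F N ζ) → B12Sec2to5.Lemma4Printed (X' P).F12 (X' P).c12 →
          B13.Lemma1Printed (X' P).S13 (X' P).c13 ∧ B13.Lemma2Printed (X' P).S13 (X' P).c13 ∧
            B13.Lemma3Printed (X' P).S13 (X' P).c13)
    (h11 : ∀ P : B12.RunParams, (leavesP w P).b7 → (leavesP w P).b8 → (leavesP w P).b9 → (leavesP w P).b10 → (leavesP w P).b11 →
      (leavesP w P).smallCouplings → (leavesP w P).smallFieldInductive → (leavesP w P).flowControl →
        ∀ k, k < P.K → SLaw₁₃CoPH F N θ P k → TLaw₁₃CoPH F N θ P k)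
    (h12W : ∀ P : B12.RunParams, B15Leaf (W₀ P))
    (hR : ∀ (P : B12.RunParams) (k : ℕ), k < P.K → TLaw₁₃CoPH F N θ P k → SLaw₁₃CoPH F N θ P (k + 1))
    (v : Revision₁₃ F N θ hP) {γ₁ : ℝ} (hγ₁ : w.γ ≤ γ₁)
    (hUVV : ∀ P : B12.RunParams, (genFlow (betaOfRecord₁₃ F N θ.toStage13Params) P.g0).InInterval γ₁ P.K → ∀ k, k ≤ P.K → SLaw₁₃CoPH F N θ P k →
      ∀ U : GaugeField (F.P P.K) k (SU N),
        chiβOfRecord₁₃ F N θ.toStage13Params P.K (gOfRecord₁₃ F N θ.toStage13Params P) k U *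
              Real.exp (-(1 / (gOfRecord₁₃ F N θ.toStage13Params P k) ^ 2 * wilsonBGOfRecord F N θ.εbg P k U)
                - w.em (gOfRecord₁₃ F N θ.toStage13Params P k) * (Fintype.card (Site (F.P P.K) k) : ℝ)) ≤ v.ρ P k U ∧
        v.ρ P k U ≤ Real.exp (w.ep (gOfRecord₁₃ F N θ.toStage13Params P k) * (Fintype.card (Site (F.P P.K) k) : ℝ))) :
    ∀ P : B12.RunParams, Nodes (leavesP { w with C := (datumOfRecord₁₃SepCoPHV F N θ hP v).C } P) :=
  N24_nodes_at_revisedWorld_of_nodes12_of_rOperation_of_uvRowV θ hP v w hC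
    (fun P => (N24_nodes12_rOperation₁₃CoPH_rebindX_withB8_pinB10YZW₀_pointed θ hP.toCore hθ X' Mstar ops ζ W₀ b8sel w hC hγ hL hup h05G h06 h07 h08 h09 h09T h10 h11 h12W hR P).1)
    (fun P => (N24_nodes12_rOperation₁₃CoPH_rebindX_withB8_pinB10YZW₀_pointed θ hP.toCore hθ X' Mstar ops ζ W₀ b8sel w hC hγ hL hup h05G h06 h07 h08 h09 h09T h10 h11 h12W hR P).2)
    hγ₁ hUVV



/-! ## §3. At Part 8's S-VIEW world (the registered rung-1 world class's binding): the thirteen nodes at the RE-BOUND world from the children with N13 as the slot letter -/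

/-- **★ N24 · THE THIRTEEN NODES AT THE S-VIEW WORLD RE-BOUND TO THE REVISED DATUM** (general `N`): §0's hypotheses (children on the S-view; N13 absent) + N13's SLOT LETTER on `v.ρ` at the world's
letters ⟹ `∀ P, Nodes (leavesP {w with C := (datumOfRecord₁₃SepCoPHV θ h v).C} P)` (= §0 ∘ §1).  The engine half of LINE 2's rung 1 at the registered binding; `RecordSV`'s other clauses are
Part 8's `N24_recordS₁₃SepCoPH_of_upS_rebindX_view` (unchanged). [cite: Balaban1989LargeFieldII, Thm 1 p.355, (0.1) pp.355–356, p.387, p.391; Balaban1988Convergent, (0.2) p.244, Cor. 3 (2.50) p.264 (bookkeeping)] -/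
theorem N24_nodes13_at_revisedWorld₁₃SepCoPH_rebindXS_fourPin_pointed (θ : Stage13HParams F N) (hP : θ.Provisos₁₃SepCoPH F N) (hθ : θ.Admissible F N)
    (X' : B12.RunParams → PrintedCarriersR) (Mstar : ℕ) (ops : OpsY N θ.toStage3Params Mstar) (ζ : ResidZ F N) (lamW : ResidW F N) (w : WorldP)
    (hC : w.C = (datumOfRecord₁₃SepCoPH F N θ hP).C) (hγ : 0 < w.γ ∧ w.γ ≤ θ.γ) (hL : w.L = (θ.L : ℝ))
    (hup : ∀ P, w.up P = upOfRecord₅CS F N ((θ.rebindX F N X').view₁₃CoPHB10YZW F N Mstar ops ζ lamW) P)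
    (h05S : ∀ P : B12.RunParams, (upOfRecord₅CS F N ((θ.rebindX F N X').view₁₃CoPHB10YZW F N Mstar ops ζ lamW) P).b8)
    (h06 : B9LeafX (Y9OfRecord N θ.toStage3Params Mstar ops))
    (h07 : B11Leaf (Z11OfRecord F N ζ))
    (h08 : PrintedUV3V N θ.L)
    (h09 : ∀ P : B12.RunParams, B12Sec2to5.Lemma4Printed (X' P).F12 (X' P).c12)
    (h09T : ∀ P : B12.RunParams, (leavesP w P).smallCouplings → (leavesP w P).smallFieldInductive)
    (h10 : ∀ P : B12.RunParams, B9LeafX (Y9OfRecord N θ.toStage3Params Mstar ops) →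
      (B10.Thm1PrintedCompact (((θ.rebindX F N X').view₁₃CoPHB10YZW F N Mstar ops ζ lamW).res.X P).runs10 ∧
          B10.Thm2Printed (((θ.rebindX F N X').view₁₃CoPHB10YZW F N Mstar ops ζ lamW).res.X P).runs10) →
        B11Leaf (Z11OfRecord F N ζ) → B12Sec2to5.Lemma4Printed (X' P).F12 (X' P).c12 →
          B13.Lemma1Printed (X' P).S13 (X' P).c13 ∧ B13.Lemma2Printed (X' P).S13 (X' P).c13 ∧
            B13.Lemma3Printed (X' P).S13 (X' P).c13)
    (h11 : ∀ P : B12.RunParams, (leavesP w P).b7 → (leavesP w P).b8 → (leavesP w P).b9 → (leavesP w P).b10 → (leavesP w P).b11 →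
      (leavesP w P).smallCouplings → (leavesP w P).smallFieldInductive → (leavesP w P).flowControl →
        ∀ k, k < P.K → SLaw₁₃CoPH F N θ P k → TLaw₁₃CoPH F N θ P k)
    (h12 : ∀ P : B12.RunParams, B15Leaf (WOfRecord₁₃ F N θ.toStage13Params lamW P))
    (hR : ∀ (P : B12.RunParams) (k : ℕ), k < P.K → TLaw₁₃CoPH F N θ P k → SLaw₁₃CoPH F N θ P (k + 1))
    (v : Revision₁₃ F N θ hP) {γ₁ : ℝ} (hγ₁ : w.γ ≤ γ₁)
    (hUVV : ∀ P : B12.RunParams, (genFlow (betaOfRecord₁₃ F N θ.toStage13Params) P.g0).InInterval γ₁ P.K → ∀ k, k ≤ P.K → SLaw₁₃CoPH F N θ P k →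
      ∀ U : GaugeField (F.P P.K) k (SU N),
        chiβOfRecord₁₃ F N θ.toStage13Params P.K (gOfRecord₁₃ F N θ.toStage13Params P) k U *
              Real.exp (-(1 / (gOfRecord₁₃ F N θ.toStage13Params P k) ^ 2 * wilsonBGOfRecord F N θ.εbg P k U)
                - w.em (gOfRecord₁₃ F N θ.toStage13Params P k) * (Fintype.card (Site (F.P P.K) k) : ℝ)) ≤ v.ρ P k U ∧
        v.ρ P k U ≤ Real.exp (w.ep (gOfRecord₁₃ F N θ.toStage13Params P k) * (Fintype.card (Site (F.P P.K) k) : ℝ))) :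
    ∀ P : B12.RunParams, Nodes (leavesP { w with C := (datumOfRecord₁₃SepCoPHV F N θ hP v).C } P) :=
  N24_nodes_at_revisedWorld_of_nodes12_of_rOperation_of_uvRowV θ hP v w hC
    (fun P => (N24_nodes12_rOperation₁₃CoPH_rebindXS_fourPin_pointed θ hP.toCore hθ X' Mstar ops ζ lamW w hC hγ hL hup h05S h06 h07 h08 h09 h09T h10 h11 h12 hR P).1)
    (fun P => (N24_nodes12_rOperation₁₃CoPH_rebindXS_fourPin_pointed θ hP.toCore hθ X' Mstar ops ζ lamW w hC hγ hL hup h05S h06 h07 h08 h09 h09T h10 h11 h12 hR P).2)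
    hγ₁ hUVV


/-! ## §4. LINE 2's RUNG-1 BODY (`NodesAtSomeRecord13PWSV` with `RecordSV` written out, general `N`) over the S-view of `θ.rebindX X′`, N13 as the slot letter — Part 8's rung-1 lemma re-cut to the slot -/

/-- **★★ THE BODY OF LINE 2's RUNG 1 `NodesAtSomeRecord13PWSV` (v9 :387, `RecordSV` UNFOLDED; general `N`) OVER THE S-BOUND FOUR-PIN VIEW OF `θ.rebindX X′`** — Part 8's
`N24_nodesAtSomeRecordS₁₃SepCoPH_of_rebindXS_fourPin_pointed` (PinX3HS :440) with N13's pointwise row `hUV` REPLACED by a version `v : Revision₁₃ θ hP`, a threshold `γ₁ ≥ w.γ` and the SLOT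
LETTER `hUVV` on `v.ρ`: witnesses `(θ, hP, v, {w with C := (datumⱽ v).C})` and `λ := λW`; `RecordSV`'s body = Part 8's S-class lemma with only the C-clause new (`rfl`); the thirteen nodes by §3;
N08's conjunct = `h08`; the [IV] pin from dag-n10-d's four-pin leaves (`upOfRecord₅C_view₁₃CoPHB10YZW_leaves`; the re-bound world keeps `w.up`).  COMPOSITE: the rung's body GIVEN the children
and the slot letter; nothing discharged; the rung's world class is displayed AS REGISTERED (S-view `upOfRecord₅CS`, un-guarded pin — plan g86 R1W pending). [cite: Balaban1989LargeFieldII, Thm 1 p.355, (0.1) pp.355–356, p.387, p.391; Balaban1988Convergent, (0.2) p.244, Cor. 3 (2.50) p.264, Thm 2 p.263; Balaban1985RegularSpaces, Prop. 7 (1.145) p.100, Thm 8 (1.146) p.101; Balaban1985UV3, Thm 1 p.257; Balaban1985Variational, Thm 1 p.279, Prop. 8 p.304; Balaban1987RG1, Thm 3 p.264, Lemma 4 p.280, (0.17)–(0.20) pp.255–256; Balaban1989LargeFieldI, (0.2)–(0.6) p.176 (bookkeeping)] -/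
theorem N24_nodesAtSomeRecordSV₁₃SepCoPH_of_rebindXS_fourPin_pointed_slotLetter (θ : Stage13HParams F N) (hP : θ.Provisos₁₃SepCoPH F N) (hθ : θ.Admissible F N)
    (hU : θ.ZhUnity F N ∧ θ.SlotsNondegenerate₁₃ F N)
    (X' : B12.RunParams → PrintedCarriersR) (Mstar : ℕ) (ops : OpsY N θ.toStage3Params Mstar) (ζ : ResidZ F N) (lamW : ResidW F N) (w : WorldP)
    (hC : w.C = (datumOfRecord₁₃SepCoPH F N θ hP).C) (hγ : 0 < w.γ ∧ w.γ ≤ θ.γ) (hL : w.L = (θ.L : ℝ))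
    (hup : ∀ P, w.up P = upOfRecord₅CS F N ((θ.rebindX F N X').view₁₃CoPHB10YZW F N Mstar ops ζ lamW) P)
    (h05S : ∀ P : B12.RunParams, (upOfRecord₅CS F N ((θ.rebindX F N X').view₁₃CoPHB10YZW F N Mstar ops ζ lamW) P).b8)
    (h06 : B9LeafX (Y9OfRecord N θ.toStage3Params Mstar ops))
    (h07 : B11Leaf (Z11OfRecord F N ζ))
    (h08 : PrintedUV3V N θ.L)
    (h09 : ∀ P : B12.RunParams, B12Sec2to5.Lemma4Printed (X' P).F12 (X' P).c12)
    (h09T : ∀ P : B12.RunParams, (leavesP w P).smallCouplings → (leavesP w P).smallFieldInductive)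
    (h10 : ∀ P : B12.RunParams, B9LeafX (Y9OfRecord N θ.toStage3Params Mstar ops) →
      (B10.Thm1PrintedCompact (((θ.rebindX F N X').view₁₃CoPHB10YZW F N Mstar ops ζ lamW).res.X P).runs10 ∧
          B10.Thm2Printed (((θ.rebindX F N X').view₁₃CoPHB10YZW F N Mstar ops ζ lamW).res.X P).runs10) →
        B11Leaf (Z11OfRecord F N ζ) → B12Sec2to5.Lemma4Printed (X' P).F12 (X' P).c12 →
          B13.Lemma1Printed (X' P).S13 (X' P).c13 ∧ B13.Lemma2Printed (X' P).S13 (X' P).c13 ∧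
            B13.Lemma3Printed (X' P).S13 (X' P).c13)
    (h11 : ∀ P : B12.RunParams, (leavesP w P).b7 → (leavesP w P).b8 → (leavesP w P).b9 → (leavesP w P).b10 → (leavesP w P).b11 →
      (leavesP w P).smallCouplings → (leavesP w P).smallFieldInductive → (leavesP w P).flowControl →
        ∀ k, k < P.K → SLaw₁₃CoPH F N θ P k → TLaw₁₃CoPH F N θ P k)
    (h12 : ∀ P : B12.RunParams, B15Leaf (WOfRecord₁₃ F N θ.toStage13Params lamW P))
    (hR : ∀ (P : B12.RunParams) (k : ℕ), k < P.K → TLaw₁₃CoPH F N θ P k → SLaw₁₃CoPH F N θ P (k + 1))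
    (v : Revision₁₃ F N θ hP) {γ₁ : ℝ} (hγ₁ : w.γ ≤ γ₁)
    (hUVV : ∀ P : B12.RunParams, (genFlow (betaOfRecord₁₃ F N θ.toStage13Params) P.g0).InInterval γ₁ P.K → ∀ k, k ≤ P.K → SLaw₁₃CoPH F N θ P k →
      ∀ U : GaugeField (F.P P.K) k (SU N),
        chiβOfRecord₁₃ F N θ.toStage13Params P.K (gOfRecord₁₃ F N θ.toStage13Params P) k U *
              Real.exp (-(1 / (gOfRecord₁₃ F N θ.toStage13Params P k) ^ 2 * wilsonBGOfRecord F N θ.εbg P k U)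
                - w.em (gOfRecord₁₃ F N θ.toStage13Params P k) * (Fintype.card (Site (F.P P.K) k) : ℝ)) ≤ v.ρ P k U ∧
        v.ρ P k U ≤ Real.exp (w.ep (gOfRecord₁₃ F N θ.toStage13Params P k) * (Fintype.card (Site (F.P P.K) k) : ℝ)))
    (hK : ∀ P : B12.RunParams, 1 ≤ P.K → lamW.kSel P < P.K) :
    ∃ (θ : Stage13HParams F N) (hP : θ.Provisos₁₃SepCoPH F N) (v : Revision₁₃ F N θ hP) (w : WorldP), (θ.ZhUnity F N ∧ θ.SlotsNondegenerate₁₃ F N) ∧ θ.Admissible F N ∧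
      (∃ (θ' : Stage13HParams F N) (h' : θ'.Provisos₁₃SepCoPH F N), θ'.Admissible F N ∧
      datumOfRecord₁₃SepCoPH F N θ hP = datumOfRecord₁₃SepCoPH F N θ' h' ∧ w.C = (datumOfRecord₁₃SepCoPHV F N θ hP v).C ∧ (0 < w.γ ∧ w.γ ≤ θ'.γ) ∧
      w.L = (θ'.L : ℝ) ∧ ∀ P : B12.RunParams, w.up P = upOfRecord₅CS F N (θ'.toStage5₁₃CoPH F N) P) ∧
      (∀ P : B12.RunParams, Nodes (leavesP w P)) ∧ PrintedUV3V N θ.L ∧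
      ∃ lam : ResidW F N, (∀ P : B12.RunParams, 1 ≤ P.K → lam.kSel P < P.K) ∧
        ∀ P : B12.RunParams, lam.kSel P < P.K → ((leavesP w P).rBasicStep ↔ B15Leaf (WOfRecord₁₃ F N θ.toStage13Params lam P)) := by
  obtain ⟨θ', h', hθ', hD, -, hγ', hL', hup'⟩ := N24_recordS₁₃SepCoPH_of_upS_rebindX_view θ hP hθ X' Mstar ops ζ lamW w hC hγ hL hup
  refine ⟨θ, hP, v, { w with C := (datumOfRecord₁₃SepCoPHV F N θ hP v).C }, hU, hθ, ⟨θ', h', hθ', hD, rfl, hγ', hL', hup'⟩,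
    N24_nodes13_at_revisedWorld₁₃SepCoPH_rebindXS_fourPin_pointed θ hP hθ X' Mstar ops ζ lamW w hC hγ hL hup h05S h06 h07 h08 h09 h09T h10 h11 h12 hR v hγ₁ hUVV,
    h08, lamW, hK, fun P _ => ?_⟩
  show (w.up P).rBasicStep ↔ _
  rw [hup P]
  exact (upOfRecord₅C_view₁₃CoPHB10YZW_leaves F N (θ.rebindX F N X') Mstar ops ζ lamW P).1

end Summit.QuantumFields.YangMills.BalabanUVNodes.N24NodesAtRevisedWorldOfNodes12SlotLetter

end
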